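import Mathlib
import HarnessLib
import Summits.ABC.ABC.Theses.CongruentialReceptacle
import Summits.ABC.ABC.Theorems.CongruentialReceptacleCompactBalanceTransferPowerDeep
import Summits.ABC.ABC.Cruxes.CompactBalanceTransfer.Ladder

/-!
# `special` — the PROVED floor under line `NextRungFreySzpiro` (F3 witness; sorry-free)

Crux `CompactBalanceTransfer` (stmt-ABC-1725), route `CongruentialReceptacle`; line `Lines/NextRungFreySzpiro.lean`
(planner, unit `fwd-harvest-ABC-50`, 2026-08-17). This file records, with kernel-checked proofs and NO `sorry`:

* `rung_at_threeHalves` — the rung family `RungBTheta (1/3) θ` HOLDS at the floor exponent `θ = 3/2` (Oesterlé 1988: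
  Szpiro `6+ε` for all Frey curves ⟹ abc with exponent `3/2+ε`; tree: `Ladder.rungBTheta_third_threeHalves`, from the general
  floor law `Ladder.rungBTheta_floor : B < 1 → RungBTheta B (1/(1−B))`, itself the `B`-graded form of
  `PowerDeep.abc_threeHalves_of_freySzpiro`). Source of the exponent: [SilvermanAEC2009, Prop. VIII.11.5(a), p. 223];
  [Oesterle1988, §3].
* `nextRung_iff` — the OPEN rung `Ladder.NextRungFreySzpiro` is literally `∃ θ < 3/2, RungBTheta (1/3) θ`: the special case
  `θ = 3/2` is the theorem above, the case `θ < 3/2` is the line's target. The witness regime is "all abc-triples, hypothesis of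
  Szpiro/discriminant type only" — `S = ABC` is NOT known there (no unconditional abc exponent is known at all), so the rung sits
  outside `S`'s proved regime (G4 brief F3 / BC5).
* `moderate_endpoint_zero` — the `η → 0` endpoint of the line's `stub_moderateRegime` in `F`-currency (`F → abc_{3/2+ε}` for ALL
  triples) is the tree theorem `PowerDeep.abc_threeHalves_of_freySzpiro` (p138328); the `η → 1` endpoint is inside the proof of
  `PowerDeep.abc_of_freySzpiro_of_powerDeep` (p138328).
* `floor_law` — the general floor, for the record.
-/

-- `Summit.<Summit>.<Problem>`: for the single-conjunct summit `ABC` the duplicate `ABC.ABC` is mandated.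
set_option linter.dupNamespace false

namespace Summit.ABC.ABC.Cruxes.CompactBalanceTransfer.NextRungFreySzpiroLine.Special

open Literature.NumberTheory.DiophantineGeometry
open Summit.ABC.ABC.Theses.CongruentialReceptacle
open Summit.ABC.ABC.Theorems.CompactBalanceTransfer
open Summit.ABC.ABC.Cruxes.CompactBalanceTransfer.Ladder

/-- **F3 witness.** The rung family at the floor exponent: `PolyBalancedABC (1/3) → AbcExp (3/2)` (Oesterlé's `3/2`).
[cite: Oesterle1988, §3] [cite: SilvermanAEC2009, Prop. VIII.11.5] -/
theorem rung_at_threeHalves : RungBTheta (1 / 3) (3 / 2) := rungBTheta_third_threeHalves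

/-- The open rung, unfolded: some exponent STRICTLY below the witness's `3/2`. [folklore] -/
theorem nextRung_iff : NextRungFreySzpiro ↔ ∃ θ : ℝ, θ < 3 / 2 ∧ RungBTheta (1 / 3) θ := Iff.rfl

/-- The general floor law of the `θ`-sub-ladder (proved in `Ladder.lean`). [folklore] -/
theorem floor_law {B : ℝ} (hB : B < 1) : RungBTheta B (1 / (1 - B)) := rungBTheta_floor hB

/-- `η → 0` endpoint of `stub_moderateRegime`, in `F`-currency: Szpiro `6+ε` for all Frey curves gives abc with exponent
`3/2 + ε` on ALL triples (tree theorem, p138328). [cite: Oesterle1988, §3] -/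
theorem moderate_endpoint_zero
    (hF : ∀ ε : ℝ, 0 < ε → ∃ C : ℝ, ∀ a b c : ℕ, IsABCTriple a b c →
      ((a * b * c : ℕ) : ℝ) ^ 2 ≤ C * ((rad a b c : ℕ) : ℝ) ^ (6 + ε)) :
    ∀ ε : ℝ, 0 < ε → ∃ C : ℝ, 0 < C ∧ ∀ a b c : ℕ, IsABCTriple a b c →
      (c : ℝ) < C * ((rad a b c : ℕ) : ℝ) ^ (3 / 2 + ε) :=
  PowerDeep.abc_threeHalves_of_freySzpiro hF

/-- ON-PATH / CONVERSE record (both proved in `Ladder.lean`): the crux and `ABC` each give the rung. [folklore] -/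
theorem onPath_and_converse :
    (CompactBalanceTransfer → NextRungFreySzpiro) ∧ (_root_.ABC → NextRungFreySzpiro) :=
  ⟨nextRungFreySzpiro_of_crux, nextRungFreySzpiro_of_abc⟩

end Summit.ABC.ABC.Cruxes.CompactBalanceTransfer.NextRungFreySzpiroLine.Special
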